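import Summits.ResolutionOfSingularities.ResolutionOfSingularities.Theses.UniversalCells
import Summits.ResolutionOfSingularities.ResolutionOfSingularities.Theorems.UniversalCellsLocalToGlobalLocalUniformizationNhds
import HarnessLib

/-!
# `LocalToGlobal` (crux stmt-ResolutionOfSingularities-15232): pointwise Zariski-local
# resolvability over `𝔽_p` gives relative local uniformization over `𝔽_p`

Route `ResolutionOfSingularities/UniversalCells`, crux #4 `LocalToGlobal`
(`∀ p prime, H_p → R_p`). Consequences of the local "resolution ⇒ local uniformization" theorem
`exists_fg_regular_of_locallyResolvable` (`UniversalCellsLocalToGlobalLocalUniformizationNhds.lean`):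

* `exists_affineModel_regular_of_locallyResolvable` — over a ground field `k`: an affine model
  `A ⊆ O` of `K/k` whose `Spec` is locally resolvable at every point is dominated by a finitely
  generated affine model `A ⊆ A' ⊆ O` regular at the centre of `O`.
* `lurel_primeField_of_locallyResolvable` — **`H_p ⇒ LUrel(𝔽_p)`**: under the antecedent of the
  crux at the prime `p`, the antecedent of `Valuative.PatchingRel` (stmt-0642) holds AT THE PRIME
  FIELD `k = ZMod p` (relative local uniformization of every valuation ring of every finitely
  generated `K/𝔽_p`, dominating any prescribed finitely generated `R ⊆ O`).
* `relLocalUniformization_primeField_of_locallyResolvable`,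
  `isLocallyUniformizable_primeField_of_locallyResolvable` — the same in the tree's two other
  vocabularies: `RelLocalUniformization (ZMod p) K O` (Novacoski–Spivakovsky form) and absolute
  (weak) local uniformization `IsLocallyUniformizable (ZMod p) K O`.
* `localToGlobal_of_patching_primeField` — **the crux is implied by Zariski's patching programme
  at the prime field**: if, for every prime `p`, relative local uniformization over `𝔽_p` implies
  resolution of integral separated finite-type `𝔽_p`-schemes (the `k = 𝔽_p` slice of
  `Valuative.PatchingRel` / `Valuative.Patching`, stmt-0642 / stmt-0561), then `LocalToGlobal`.

Nothing here proves the crux (open: Zariski-local-to-global for bare existence of resolutions,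
dimension `≥ 4`); these are certificates for the lead's recommended weak re-lining of the atom
("Res₄ ⇐ LU + FFR₄ + CP2019General; under `H_p`, LU over `𝔽_p` is free",
`Cruxes/LocalToGlobal/LINE-STATUS.md`) and the formal content of the crux docstring's comparison
with `Valuative.PatchingRel` (one direction only; no converse is claimed).
-/

noncomputable section

-- single-problem summit: the doubled namespace component `ResolutionOfSingularities` is forced
set_option linter.dupNamespace false

open CategoryTheory AlgebraicGeometry TopologicalSpace IsLocalRing
open Literature.AlgebraicGeometry.Resolution
open Summit.ResolutionOfSingularities.ResolutionOfSingularities.Theses.UniversalCells (LocalToGlobal)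

namespace Summit.ResolutionOfSingularities.ResolutionOfSingularities.Theorems

universe u

/-! ## Over a ground field: affine models, and the prime field of the crux -/

section OverField

/-- If `Spec A` is locally resolvable at every point, an affine model `A ⊆ O` of `K/k` is
dominated by a finitely generated affine model `A ⊆ A' ⊆ O` regular at the centre of `O` (the
relative local uniformization step; compare `exists_affineModel_regular_of_hasResolution`,
which needs a resolution of all of `Spec A`). [folklore] -/
theorem exists_affineModel_regular_of_locallyResolvable {k K : Type} [Field k] [Field K]
    [Algebra k K] (O : ValuationSubring K) (A : Subalgebra k K)
    (hAO : A.toSubring ≤ O.toSubring) (hfg : A.FG) (hfr : IsFractionRing A K)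
    (hloc : ∀ x : Spec (.of A), ∃ W : (Spec (.of A)).Opens, x ∈ W ∧
      Scheme.HasResolution (W : Scheme.{0})) :
    ∃ (A' : Subalgebra k K) (h : A'.toSubring ≤ O.toSubring), A ≤ A' ∧ A'.FG ∧
      IsRegularLocalRing (Localization.AtPrime (centreIdeal A' O h)) := by
  classical
  haveI := hfr
  obtain ⟨T, hTO, hTfg, hreg⟩ :=
    exists_fg_regular_of_locallyResolvable A K O (fun a => hAO a.2) hloc
  obtain ⟨s₀, rfl⟩ := hfg
  obtain ⟨t, ht⟩ := hTfg
  have e : (Algebra.adjoin k ((s₀ : Set K) ∪ (t : Set K))).toSubring = T.toSubring := by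
    rw [Algebra.adjoin_union_eq_adjoin_adjoin, ← ht]
    rfl
  have h' : (Algebra.adjoin k ((s₀ : Set K) ∪ (t : Set K))).toSubring ≤ O.toSubring := by
    rw [e]; exact hTO
  refine ⟨_, h', Algebra.adjoin_mono Set.subset_union_left, ⟨s₀ ∪ t, by push_cast; rfl⟩,
    isRegularLocalRing_centre_of_toSubring_eq O _ h' hTO e hreg⟩

/-- The prime field `𝔽_p = ZMod p` lies in every valuation ring (indeed in every subring) of a
field `K` of characteristic `p`: its elements are images of natural numbers. [folklore] -/
theorem algebraMap_zmod_mem_valuationSubring (p : ℕ) [Fact p.Prime] {K : Type u} [Field K]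
    [Algebra (ZMod p) K] (O : ValuationSubring K) (c : ZMod p) : algebraMap (ZMod p) K c ∈ O := by
  have hc : ((c.val : ℕ) : ZMod p) = c := ZMod.natCast_zmod_val c
  rw [← hc, map_natCast]
  exact natCast_mem O.toSubring c.val

/-- Under the antecedent `H_p` of the crux, the spectrum of a finitely generated
`𝔽_p`-subalgebra `R` of a field `K` is locally resolvable at every point: `Spec R` is an
integral (`R ⊆ K` is a domain) affine — hence separated and quasi-compact — scheme of finite
type over `Spec 𝔽_p`. [folklore] -/
theorem locallyResolvable_spec_subalgebra_of_locallyResolvable (p : ℕ) [Fact p.Prime]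
    (hloc : ∀ (X : Scheme.{0}) (f : X ⟶ Spec (.of (ZMod p))), IsSeparated f →
      LocallyOfFiniteType f → QuasiCompact f → IsIntegral X →
        ∀ x : X, ∃ U : X.Opens, x ∈ U ∧ Scheme.HasResolution (U : Scheme.{0}))
    {K : Type} [Field K] [Algebra (ZMod p) K] (R : Subalgebra (ZMod p) K) (hRfg : R.FG) :
    ∀ x : Spec (.of R), ∃ W : (Spec (.of R)).Opens, x ∈ W ∧
      Scheme.HasResolution (W : Scheme.{0}) := by
  haveI : Algebra.FiniteType (ZMod p) R := R.fg_iff_finiteType.mp hRfg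
  let f : Spec (.of R) ⟶ Spec (.of (ZMod p)) :=
    Spec.map (CommRingCat.ofHom (algebraMap (ZMod p) R))
  haveI : LocallyOfFiniteType f :=
    (HasRingHomProperty.Spec_iff (P := @LocallyOfFiniteType)).mpr
      (RingHom.finiteType_algebraMap.mpr ‹_›)
  haveI : IsDomain (CommRingCat.of R) := inferInstanceAs (IsDomain R)
  exact hloc (Spec (.of R)) f inferInstance inferInstance inferInstance inferInstance

/-- **`H_p ⇒ LUrel(𝔽_p)`: pointwise Zariski-local resolvability over the prime field gives
relative local uniformization over the prime field.** Under the antecedent of `LocalToGlobal` at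
the prime `p` (every point of every integral separated finite-type `𝔽_p`-scheme has an open
neighbourhood with a resolution), for every finitely generated field `K/𝔽_p`, every valuation
ring `O` of `K` and every finitely generated `𝔽_p`-subalgebra `R ⊆ O` there is a finitely
generated `𝔽_p`-subalgebra `A` with `R ⊆ A ⊆ O`, `Frac A = K` and `A` regular at the centre
`𝔪_O ∩ A` — the antecedent of `Valuative.PatchingRel` (stmt-0642) at `k = ZMod p`. Proof:
enlarge `R` by an affine model of `O` (`exists_affineModel`), apply the crux's antecedent to the
integral affine finite-type `𝔽_p`-scheme `Spec (R ⊔ A₀)` and uniformize by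
`exists_affineModel_regular_of_locallyResolvable`. This is the Lean content of the crux
docstring's "Zariski-local resolutions give relative local uniformization along every
valuation (centre of the valuation on the local resolution)". [folklore] -/
theorem lurel_primeField_of_locallyResolvable (p : ℕ) [Fact p.Prime]
    (hloc : ∀ (X : Scheme.{0}) (f : X ⟶ Spec (.of (ZMod p))), IsSeparated f →
      LocallyOfFiniteType f → QuasiCompact f → IsIntegral X →
        ∀ x : X, ∃ U : X.Opens, x ∈ U ∧ Scheme.HasResolution (U : Scheme.{0}))
    (K : Type) [Field K] [Algebra (ZMod p) K] (hKfg : (⊤ : IntermediateField (ZMod p) K).FG)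
    (O : ValuationSubring K) (R : Subalgebra (ZMod p) K) (hRfg : R.FG)
    (hRO : R.toSubring ≤ O.toSubring) :
    ∃ (A : Subalgebra (ZMod p) K) (h : A.toSubring ≤ O.toSubring), R ≤ A ∧ A.FG ∧
      IsFractionRing A K ∧ IsRegularLocalRing (Localization.AtPrime
        (Ideal.comap (Subring.inclusion h) (IsLocalRing.maximalIdeal O))) := by
  classical
  have hO : ∀ c : ZMod p, algebraMap (ZMod p) K c ∈ O := algebraMap_zmod_mem_valuationSubring p O
  obtain ⟨A₀, hA₀O, hA₀fg, hA₀fr⟩ := exists_affineModel (ZMod p) K hKfg O hO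
  have hR'O : (R ⊔ A₀).toSubring ≤ O.toSubring := by
    let Oalg : Subalgebra (ZMod p) K := { O.toSubring with algebraMap_mem' := hO }
    change R ⊔ A₀ ≤ Oalg
    exact sup_le (fun x hx => hRO hx) (fun x hx => hA₀O hx)
  have hR'fr : IsFractionRing ↥(R ⊔ A₀) K := isFractionRing_of_le le_sup_right hA₀fr
  have hR'fg : (R ⊔ A₀).FG := hRfg.sup hA₀fg
  obtain ⟨A, hA, hle, hAfg, hreg⟩ :=
    exists_affineModel_regular_of_locallyResolvable O (R ⊔ A₀) hR'O hR'fg hR'fr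
      (locallyResolvable_spec_subalgebra_of_locallyResolvable p hloc (R ⊔ A₀) hR'fg)
  exact ⟨A, hA, le_sup_left.trans hle, hAfg, isFractionRing_of_le hle hR'fr, hreg⟩

/-- Under `H_p`, every valuation ring `O` of every field `K ⊇ 𝔽_p` satisfies **relative local
uniformization over `𝔽_p` in the Novacoski–Spivakovsky form** `RelLocalUniformization (ZMod p) K O`
(every finitely generated affine model `R ⊆ O` of `K` is dominated by one regular at the centre;
no finite generation hypothesis on `K` is needed, the models carry it). [folklore] -/
theorem relLocalUniformization_primeField_of_locallyResolvable (p : ℕ) [Fact p.Prime]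
    (hloc : ∀ (X : Scheme.{0}) (f : X ⟶ Spec (.of (ZMod p))), IsSeparated f →
      LocallyOfFiniteType f → QuasiCompact f → IsIntegral X →
        ∀ x : X, ∃ U : X.Opens, x ∈ U ∧ Scheme.HasResolution (U : Scheme.{0}))
    (K : Type) [Field K] [Algebra (ZMod p) K] (O : ValuationSubring K) :
    RelLocalUniformization (ZMod p) K O :=
  fun R hRfg hRfr hRO =>
    exists_affineModel_regular_of_locallyResolvable O R hRO hRfg hRfr
      (locallyResolvable_spec_subalgebra_of_locallyResolvable p hloc R hRfg)

/-- In particular, under `H_p` every valuation ring of every finitely generated `K/𝔽_p` is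
(weakly, absolutely) locally uniformizable over `𝔽_p` (`IsLocallyUniformizable`; take `R = ⊥`).
[folklore] -/
theorem isLocallyUniformizable_primeField_of_locallyResolvable (p : ℕ) [Fact p.Prime]
    (hloc : ∀ (X : Scheme.{0}) (f : X ⟶ Spec (.of (ZMod p))), IsSeparated f →
      LocallyOfFiniteType f → QuasiCompact f → IsIntegral X →
        ∀ x : X, ∃ U : X.Opens, x ∈ U ∧ Scheme.HasResolution (U : Scheme.{0}))
    (K : Type) [Field K] [Algebra (ZMod p) K] (hKfg : (⊤ : IntermediateField (ZMod p) K).FG)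
    (O : ValuationSubring K) : IsLocallyUniformizable (ZMod p) K O := by
  have hbot : (⊥ : Subalgebra (ZMod p) K).toSubring ≤ O.toSubring := by
    intro x hx
    obtain ⟨c, rfl⟩ := Algebra.mem_bot.mp hx
    exact algebraMap_zmod_mem_valuationSubring p O c
  obtain ⟨A, hA, -, hAfg, hAfr, hreg⟩ :=
    lurel_primeField_of_locallyResolvable p hloc K hKfg O ⊥ Subalgebra.fg_bot hbot
  exact ⟨A, hA, hAfg, hAfr, hreg⟩

/-- **The crux `LocalToGlobal` is implied by Zariski's patching programme AT THE PRIME FIELD.**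
If, for every prime `p`, relative local uniformization over `𝔽_p` (the antecedent of
`Valuative.PatchingRel`, stmt-0642, at `k = ZMod p`) implies that every integral separated
finite-type `𝔽_p`-scheme has a resolution, then `LocalToGlobal` holds: its antecedent `H_p`
supplies the local uniformizations (`lurel_primeField_of_locallyResolvable`). This makes the
crux docstring's "strictly weaker than Valuative's `PatchingRel`" precise in the one direction
that is formal (the patching hypothesis is needed only over `𝔽_p` and only with conclusion over
`𝔽_p`; no converse is claimed). [folklore] -/
theorem localToGlobal_of_patching_primeField
    (hP : ∀ (p : ℕ) [Fact p.Prime],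
      (∀ (K : Type) [Field K] [Algebra (ZMod p) K], (⊤ : IntermediateField (ZMod p) K).FG →
        ∀ O : ValuationSubring K, (∀ c : ZMod p, algebraMap (ZMod p) K c ∈ O) →
          ∀ R : Subalgebra (ZMod p) K, R.FG → R.toSubring ≤ O.toSubring →
            ∃ (A : Subalgebra (ZMod p) K) (h : A.toSubring ≤ O.toSubring), R ≤ A ∧ A.FG ∧
              IsFractionRing A K ∧ IsRegularLocalRing (Localization.AtPrime
                (Ideal.comap (Subring.inclusion h) (IsLocalRing.maximalIdeal O)))) →
      ∀ (X : Scheme.{0}) (f : X ⟶ Spec (.of (ZMod p))), IsSeparated f → LocallyOfFiniteType f →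
        QuasiCompact f → IsIntegral X → Scheme.HasResolution X) :
    LocalToGlobal := by
  intro p hp hloc X f hs hl hq hi
  haveI : Fact p.Prime := ⟨hp⟩
  exact hP p (fun K _ _ hKfg O _ R hRfg hRO =>
    lurel_primeField_of_locallyResolvable p hloc K hKfg O R hRfg hRO) X f hs hl hq hi

end OverField

end Summit.ResolutionOfSingularities.ResolutionOfSingularities.Theorems

end
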